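import Summits.QuantumFields.YangMills.Theorems.AlphaInputsT3ACv3StartDefectTwoCell
import HarnessLib

/-!
# `AlphaInputsT3ACv3StartDefectTwoCellTgt` — non-abelian (FL), START v3 ∕ M22 chart: **THE TWO-CELL CHART READ FROM THE CENTRE OF `c₊`** — the comb-fan binders `hwrap`, `hfan`, `hl1` of
# ★w1 g0's `RegionAxialGauge.dist1_gaugeActT_axialT_le_of_box` for the axial gauge based at `ĉ₊ = toFine k c.tgt`, on the SAME product set `twoCellSet k c` (the two k-blocks of `c`):
# `rel ĉ₊ x = rel ĉ₋ x − Lᵏ·e_{c.dir}`, windows `[−Lᵏ−h, h]` along `c` and `[−h, h]` across, `l1 ≤ d·⌊Lᵏ/2⌋ + Lᵏ`, fans inside — cell `ym3-torus`, width seat `ym-ust-19936-w5` (g2);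
# ★w4-19936 g2's LOCATED 03:49:14Z («the last chart letter» for (δ) of `exists_obLift_gaugeKernel`: flatness of `axialT U₀ (toFine k (blk (z+e_μ)))` on face-straddling plaquettes)

WHAT.  `toFine_tgt_apply` (`ĉ₊_κ = ĉ₋_κ + [κ = c.dir]·Lᵏ`, via `toFine_shift`∕`transl_lineVec`), `rel_toFine_tgt_eq_of_offset`, `rel_window_tgt`, ★ `hwrap_twoCell_tgt`, ★ `hl1_twoCell_tgt`,
★ `hfan_twoCell_tgt` — mirror images of `…StartDefectTwoCell` §2 (base `ĉ₋`).  Def-free.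
HONEST FRAMING.  Torus-label bookkeeping; count-neutral helper toward R3 2′ (items 19936∕19935, `--supports stmt-QuantumFields-19936`); `hLift`∕(FL), the stub, the crux and the gap are NOT
claimed; registry untouched; YM₃ on T³ is rung R3 of the YM ladder, not the Clay problem.

References: T. Bałaban, Commun. Math. Phys. 109 (1987) 249–301 [Balaban1987RG1] ((0.1) p.251); Commun. Math. Phys. 98 (1985) 17–51 [Balaban1985Averaging] (pp.24–25).
-/

set_option autoImplicit false

namespace Summit.QuantumFields.YangMills.Theorems.StartDefectBox

open Literature.MathematicalPhysics.QuantumFieldTheory.Balaban1983to89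
open T4Continuum
open Literature.MathematicalPhysics.QuantumFieldTheory.Balaban1983to89.B5Eq118OneStroke (iterBlockOf)
open Literature.MathematicalPhysics.QuantumFieldTheory.Balaban1983to89.B10Eq38TorusDomains (toFine)
open Literature.MathematicalPhysics.QuantumFieldTheory.Balaban1983to89.B10Eq27TorusAxialLog (rel rel_apply rel_shift_of_le transl transl_apply)
open Literature.MathematicalPhysics.QuantumFieldTheory.Balaban1983to89.B7Prop1Explicit (l1 e e_apply)

variable {P : Params} {k : ℕ}

/-- **THE CENTRE OF `c₊` FROM THE CENTRE OF `c₋`**: `ĉ₊_κ = ĉ₋_κ + [κ = c.dir]·Lᵏ` (`k ≤ m + K`). [cite: Balaban1987RG1, (0.1) p.251] -/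
theorem toFine_tgt_apply (hk : k ≤ P.m + P.K) (c : PBond P k) (κ : Fin P.d) :
    (toFine k c.tgt) κ = (toFine k c.src) κ + (((if κ = c.dir then (P.L ^ k : ℕ) else 0 : ℕ) : ℕ) : ZMod (P.sitesPerDir 0)) := by
  have h : toFine k c.tgt = transl (toFine k c.src) (lineVec c.dir (P.L ^ k)) := by
    rw [show c.tgt = c.src.shift c.dir from rfl, toFine_shift hk, transl_lineVec]
  rw [h, transl_apply]
  simp only [lineVec]
  split_ifs <;> simp

/-- **THE RELATIVE POSITION FROM `ĉ₊`, FROM THE OFFSET** (`4Lᵏ ≤ sitesPerDir 0`): if `x_κ = start_κ + u` with `u ≤ 2Lᵏ − 1` then `rel ĉ₊ x κ = u − ⌊Lᵏ/2⌋ − [κ = c.dir]·Lᵏ`.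
[cite: Balaban1985Averaging, pp.24–25] -/
theorem rel_toFine_tgt_eq_of_offset (hk : k ≤ P.m + P.K) (hN4 : 4 * P.L ^ k ≤ P.sitesPerDir 0) (c : PBond P k) (x : Site P 0) (κ : Fin P.d) {u : ℕ} (hu : u ≤ 2 * P.L ^ k - 1)
    (hx : x κ = blockStart k c κ + ((u : ℕ) : ZMod (P.sitesPerDir 0))) :
    rel (toFine k c.tgt) x κ = (u : ℤ) - ((P.L ^ k / 2 : ℕ) : ℤ) - (((if κ = c.dir then (P.L ^ k : ℕ) else 0 : ℕ) : ℕ) : ℤ) := by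
  rw [rel_apply]
  have hj : (if κ = c.dir then (P.L ^ k : ℕ) else 0 : ℕ) ≤ P.L ^ k := by split_ifs <;> omega
  set j : ℕ := (if κ = c.dir then (P.L ^ k : ℕ) else 0 : ℕ) with hjdef
  set Lk := P.L ^ k with hLk
  refine (ZMod.valMinAbs_spec _ _).mpr ⟨?_, ?_⟩
  · rw [hx, toFine_tgt_apply hk, toFine_src_eq_blockStart hk, ← hjdef, ← hLk, Int.cast_sub, Int.cast_sub, Int.cast_natCast, Int.cast_natCast, Int.cast_natCast]; abel
  · have h2 : Lk = 2 * (Lk / 2) + 1 := TubeStart.pow_eq_two_mul_half_add_one (P := P) k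
    have hpos : 0 < P.sitesPerDir 0 := Nat.pos_of_ne_zero (P.sitesPerDir_ne_zero 0)
    constructor <;> omega

/-- The window of the relative position from `ĉ₊`: `−⌊Lᵏ/2⌋ − [κ = c.dir]·Lᵏ ≤ rel ĉ₊ x κ ≤ winHi κ − ⌊Lᵏ/2⌋ − [κ = c.dir]·Lᵏ` on the two blocks. [cite: Balaban1985Averaging, pp.24–25] -/
theorem rel_window_tgt (hk : k ≤ P.m + P.K) (hN4 : 4 * P.L ^ k ≤ P.sitesPerDir 0) (c : PBond P k) (x : Site P 0) (hx : iterBlockOf k x = c.src ∨ iterBlockOf k x = c.tgt)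
    (κ : Fin P.d) :
    -((P.L ^ k / 2 : ℕ) : ℤ) - (((if κ = c.dir then (P.L ^ k : ℕ) else 0 : ℕ) : ℕ) : ℤ) ≤ rel (toFine k c.tgt) x κ ∧
      rel (toFine k c.tgt) x κ ≤ (winHi k c κ : ℤ) - ((P.L ^ k / 2 : ℕ) : ℤ) - (((if κ = c.dir then (P.L ^ k : ℕ) else 0 : ℕ) : ℕ) : ℤ) := by
  obtain ⟨j, hj, hjd, hxκ⟩ := exists_offset_of_mem_blocks hk c x hx κ
  have hs : (x κ).val % P.L ^ k < P.L ^ k := Nat.mod_lt _ (pow_pos P.L_pos k)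
  have hwin := offset_le_winHi c κ hj (fun h => (hjd h).1) hs
  have hu2 : j * P.L ^ k + (x κ).val % P.L ^ k ≤ 2 * P.L ^ k - 1 := by
    refine hwin.trans ?_
    unfold winHi; split_ifs <;> omega
  rw [rel_toFine_tgt_eq_of_offset hk hN4 c x κ hu2 hxκ]
  set r := (x κ).val % P.L ^ k with hr
  set Lk := P.L ^ k with hLk
  constructor <;> omega

/-- **★ `hwrap` FROM `ĉ₊`**: `(rel ĉ₊ x μ + 1)·2 ≤ sitesPerDir 0` on the two blocks (`4Lᵏ ≤ sitesPerDir 0`). [cite: Balaban1985Averaging, pp.24–25] -/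
theorem hwrap_twoCell_tgt (hk : k ≤ P.m + P.K) (hN4 : 4 * P.L ^ k ≤ P.sitesPerDir 0) (c : PBond P k) (x : Site P 0) (hx : iterBlockOf k x = c.src ∨ iterBlockOf k x = c.tgt)
    (μ : Fin P.d) : (rel (toFine k c.tgt) x μ + 1) * 2 ≤ (P.sitesPerDir 0 : ℤ) := by
  have h := (rel_window_tgt hk hN4 c x hx μ).2
  set Lk := P.L ^ k with hLk
  have hw : winHi k c μ ≤ 2 * Lk - 1 := by unfold winHi; split_ifs <;> omega
  have hj0 : 0 ≤ (((if μ = c.dir then (Lk : ℕ) else 0 : ℕ) : ℕ) : ℤ) := by positivity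
  have h2 : Lk = 2 * (Lk / 2) + 1 := TubeStart.pow_eq_two_mul_half_add_one (P := P) k
  omega

/-- **★ `hl1` FROM `ĉ₊`**: `l1 (rel ĉ₊ x) ≤ d·⌊Lᵏ/2⌋ + Lᵏ` on the two blocks. [cite: Balaban1985Averaging, pp.24–25] -/
theorem hl1_twoCell_tgt (hk : k ≤ P.m + P.K) (hN4 : 4 * P.L ^ k ≤ P.sitesPerDir 0) (c : PBond P k) (x : Site P 0) (hx : iterBlockOf k x = c.src ∨ iterBlockOf k x = c.tgt) :
    l1 (rel (toFine k c.tgt) x) ≤ P.d * (P.L ^ k / 2) + P.L ^ k := by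
  unfold l1
  have hb : ∀ κ, (rel (toFine k c.tgt) x κ).natAbs ≤ P.L ^ k / 2 + (if κ = c.dir then P.L ^ k else 0) := fun κ => by
    have hw := rel_window_tgt hk hN4 c x hx κ
    set Lk := P.L ^ k with hLk
    have h2 : Lk = 2 * (Lk / 2) + 1 := TubeStart.pow_eq_two_mul_half_add_one (P := P) k
    unfold winHi at hw
    split_ifs at hw ⊢ <;> push_cast at hw <;> omega
  calc ∑ κ, (rel (toFine k c.tgt) x κ).natAbs ≤ ∑ κ : Fin P.d, (P.L ^ k / 2 + (if κ = c.dir then P.L ^ k else 0)) := Finset.sum_le_sum fun κ _ => hb κ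
    _ = P.d * (P.L ^ k / 2) + P.L ^ k := by
        rw [Finset.sum_add_distrib, Finset.sum_const, Finset.card_univ, Fintype.card_fin, smul_eq_mul, Finset.sum_ite_eq' Finset.univ c.dir]
        simp

/-- **★ `hfan` FROM `ĉ₊`**: the comb fan of a bond of the two blocks, read from the centre of `c₊`, stays in the two-cell product set. [cite: Balaban1985Averaging, pp.24–25] -/
theorem hfan_twoCell_tgt (hk : k ≤ P.m + P.K) (hN4 : 4 * P.L ^ k ≤ P.sitesPerDir 0) (c : PBond P k) (x : Site P 0) (hx : iterBlockOf k x = c.src ∨ iterBlockOf k x = c.tgt)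
    (μ : Fin P.d) (hxμ : iterBlockOf k (x.shift μ) = c.src ∨ iterBlockOf k (x.shift μ) = c.tgt) (κ : Fin P.d) (t : ℤ)
    (ht1 : min 0 (min (rel (toFine k c.tgt) x κ) ((rel (toFine k c.tgt) x + e μ) κ)) ≤ t)
    (ht2 : t ≤ max 0 (max (rel (toFine k c.tgt) x κ) ((rel (toFine k c.tgt) x + e μ) κ))) :
    (toFine k c.tgt) κ + ((t : ℤ) : ZMod (P.sitesPerDir 0)) ∈ twoCellSet k c κ := by
  have hw := rel_window_tgt hk hN4 c x hx κ
  have hw' := rel_window_tgt hk hN4 c (x.shift μ) hxμ κ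
  rw [rel_shift_of_le _ _ _ (hwrap_twoCell_tgt hk hN4 c x hx μ)] at hw'
  set Lk := P.L ^ k with hLk
  set J : ℕ := (if κ = c.dir then (Lk : ℕ) else 0 : ℕ) with hJ
  have h2 : Lk = 2 * (Lk / 2) + 1 := TubeStart.pow_eq_two_mul_half_add_one (P := P) k
  have hJw : J + Lk / 2 ≤ winHi k c κ := by unfold winHi; rw [hJ]; split_ifs <;> omega
  -- `−h − J ≤ t ≤ winHi κ − h − J`
  have hlo : -((Lk / 2 : ℕ) : ℤ) - ((J : ℕ) : ℤ) ≤ t := by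
    have : -((Lk / 2 : ℕ) : ℤ) - ((J : ℕ) : ℤ) ≤ min 0 (min (rel (toFine k c.tgt) x κ) ((rel (toFine k c.tgt) x + e μ) κ)) :=
      le_min (by omega) (le_min hw.1 hw'.1)
    linarith
  have hhi : t ≤ (winHi k c κ : ℤ) - ((Lk / 2 : ℕ) : ℤ) - ((J : ℕ) : ℤ) := by
    have hw0 : (0 : ℤ) ≤ (winHi k c κ : ℤ) - ((Lk / 2 : ℕ) : ℤ) - ((J : ℕ) : ℤ) := by
      have : ((J : ℕ) : ℤ) + ((Lk / 2 : ℕ) : ℤ) ≤ (winHi k c κ : ℤ) := by exact_mod_cast hJw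
      linarith
    have : max 0 (max (rel (toFine k c.tgt) x κ) ((rel (toFine k c.tgt) x + e μ) κ)) ≤ (winHi k c κ : ℤ) - ((Lk / 2 : ℕ) : ℤ) - ((J : ℕ) : ℤ) :=
      max_le hw0 (max_le hw.2 hw'.2)
    linarith
  obtain ⟨u, hu⟩ : ∃ u : ℕ, (u : ℤ) = t + ((Lk / 2 : ℕ) : ℤ) + ((J : ℕ) : ℤ) := ⟨(t + ((Lk / 2 : ℕ) : ℤ) + ((J : ℕ) : ℤ)).toNat, by omega⟩
  refine ⟨u, by omega, ?_⟩
  rw [toFine_tgt_apply hk, toFine_src_eq_blockStart hk, ← hJ, ← hLk, add_assoc, add_assoc]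
  congr 1
  have e : (((Lk / 2 : ℕ) : ℤ) : ZMod (P.sitesPerDir 0)) + ((((J : ℕ) : ℤ) : ZMod (P.sitesPerDir 0)) + ((t : ℤ) : ZMod (P.sitesPerDir 0))) =
      (((u : ℕ) : ℤ) : ZMod (P.sitesPerDir 0)) := by
    rw [← Int.cast_add, ← Int.cast_add, hu]; congr 1; ring
  rw [Int.cast_natCast, Int.cast_natCast, Int.cast_natCast] at e
  exact e

end Summit.QuantumFields.YangMills.Theorems.StartDefectBox
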